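import Summits.BirchSwinnertonDyer.BirchSwinnertonDyer.Theorems.ErratumRoadFiveNonSurjCornerKolyJProp44H44ZhangAt
import Summits.BirchSwinnertonDyer.Rank1Residual.X11b.KolyvaginRingClassTotalRamification
import Summits.BirchSwinnertonDyer.Rank1Residual.X11b.KolyvaginPointClassFixed
import HarnessLib

/-!
# The suppliers `hsplit` ∕ `htot` ∕ `hram` of x11b3's `h44` programme RE-KEYED to ZHANG–Kolyvagin primes, and
# the END `h44` ⟸ {`h37`, dictionary} at guarded pairs (cell `bsd-stepL`, seat `bsd-stepL-corner-p1` g10;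
# `--supports stmt-BirchSwinnertonDyer-19947`; memo CORNER-G9 §5 step (2), CORNER-G10 §1)

WHY/WHAT. x11b3's suppliers `KolyvaginH44.hsplit_of_ringClassField` (X11b/KolyvaginRingClassSplitting),
`KolyvaginH44.htot_of_classFieldTheory` (X11b/KolyvaginRingClassTotalRamification) and
`KolyvaginH44.hram_of_totallyRamified_on` (X11b/KolyvaginH44Localized) discharge the END's inputs `hsplit`
(*"`λ` splits completely in `K_m`"*), `htot` ∕ `hram` (*"each prime factor of `l` in `K_m` ramifies totally in
`K_n`"*, inertia acts through `G_ℓ = ⟨σ_ℓ⟩`) by the tree's class field theory; they are keyed on GROSS primes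
(`IsKolyvaginPrime N W K p q ∧ FrobEqFrobInfty W K (p^M) q`) but use of that key ONLY the place `λ = (ℓ)` (`hℓ.place`,
`hℓ.mem_iff`, `dvd_of_natCast_mem_place`, `place_mem_splitPrimes_ringClassField`). Here the SAME three theorems with
the antecedent `Zhang2014.IsKolyvaginPrime (W.conductorNorm ℤ) W K p q ∧ M ≤ kolyvaginIndex W p q` (the corner's
levels; image-free), proofs verbatim with the place supplied from the inertness `(Ideal.span {ℓ}).IsPrime`
(`asIdeal_eq_span_of_natCast_mem`, `dvd_of_natCast_mem_of_isPrime_span`, x11b3's `not_dvd_div_of_squarefree_of_prime`; uniqueness = bsd-jet's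
`JET.RingClassTransverse.eq_of_natCast_mem_of_isPrime_span`), `hram` with the PAIR guard of
`Prop44.h44_of_prop37_of_ringClassDecomposition_at_zhang`; and the composed END
**`h44_of_prop37_at_zhang`**: McCallum Prop. 4.4 at `λ ∣ m` in order form at the Zhang–Kolyvagin pairs `(m, ℓ)`
with `R m ℓ` ⟸ {`h37` (Gross Prop. 3.7 (1)(2) with the inter-level lift) at those pairs, the Galois dictionary
(`e`, injective `ρ`, `hπρ`, `hσρ` at those pairs)} — x11b3's `h44_of_prop37_on` re-keyed, its Heegner-point and
Weil-pairing binders gone (not needed at Zhang primes: good reduction from `ℓ ∤ N_E`, bsd-jet). HONEST FRAMING: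
re-typing of kernel theorems; `h37` stays a labelled hypothesis (Gross 3.7 (2) is print); nothing about BSD; no
stub closes; T7. References: [GrossLMS1991] §3 (p. 217 l. 1–3, p. 218 l. 1), Prop. 3.7, §4 (4.1), Prop. 6.2 (2);
[McCallumLMS1991] §4 (p. 301 l. 1), Lemma 4.3, Prop. 4.4; [Cox2013] §9.A, Thm. 11.1; [WZhang2014] Notations (xii).
-/

set_option autoImplicit false
set_option linter.dupNamespace false

noncomputable section

open scoped Classical
open WeierstrassCurve Field NumberField IsDedekindDomain Finset
open Literature.NumberTheory.EllipticCurves Literature.NumberTheory.GaloisRepresentations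
open Literature.NumberTheory.EllipticCurves.KolyvaginCocycle
open Literature.NumberTheory.EllipticCurves.KolyvaginEuler
open Literature.NumberTheory.NumberFields
open Rat.HeightOneSpectrum
open Summit.BirchSwinnertonDyer.Rank1Residual.X11b
open Summit.BirchSwinnertonDyer.Rank1Residual.X11b.KolyvaginH44

namespace Summit.BirchSwinnertonDyer.BirchSwinnertonDyer.Theorems.Prop44

-- `K : Type`: the tree's ring-class class field theory is universe `0`.
variable {K : Type} [Field K] [NumberField K]

/-! ## The place `λ = (ℓ)` of an inert prime -/

/-- **A finite place containing the inert prime `ℓ` IS `(ℓ)`** (`(ℓ)` is a non-zero prime, hence maximal, ideal of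
`𝓞 K`; Gross 1991 §3 "we let `λ` denote its unique prime factor"). [cite: GrossLMS1991, §3 (after (3.2))] -/
theorem asIdeal_eq_span_of_natCast_mem {ℓ : ℕ} (hℓp : ℓ.Prime)
    (hℓP : (Ideal.span {(ℓ : 𝓞 K)}).IsPrime) {v : HeightOneSpectrum (𝓞 K)}
    (hv : (ℓ : 𝓞 K) ∈ v.asIdeal) : v.asIdeal = Ideal.span {(ℓ : 𝓞 K)} := by
  have hle : Ideal.span {(ℓ : 𝓞 K)} ≤ v.asIdeal := (Ideal.span_singleton_le_iff_mem _).mpr hv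
  have hne : Ideal.span {(ℓ : 𝓞 K)} ≠ ⊥ := by
    rw [Ne, Ideal.span_singleton_eq_bot]
    exact_mod_cast hℓp.ne_zero
  exact ((Ideal.IsPrime.isMaximal hℓP hne).eq_of_le v.isPrime.ne_top hle).symm

/-- **`λ = (ℓ) ∣ k` implies `ℓ ∣ k`** for an inert prime `ℓ` and `k ∈ ℕ` (read through the place `(ℓ)` of `ℚ`
below `λ`; x11b3's `dvd_of_natCast_mem_place` keyed on the inertness only). [folklore] -/
theorem dvd_of_natCast_mem_of_isPrime_span {ℓ : ℕ} (hℓp : ℓ.Prime) {v : HeightOneSpectrum (𝓞 K)}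
    (hv : (ℓ : 𝓞 K) ∈ v.asIdeal) {k : ℕ} (h : ((k : ℕ) : 𝓞 K) ∈ v.asIdeal) : ℓ ∣ k := by
  haveI : Fact ℓ.Prime := ⟨hℓp⟩
  obtain ⟨v₀, hv₀, hℓv₀⟩ := exists_ratPlace ℓ
  haveI := v.isPrime
  have hw : v.asIdeal.under (𝓞 ℚ) = v₀.asIdeal := Rat.under_eq_asIdeal_of_natCast_mem hℓp hℓv₀ hv
  have hk' : ((k : ℕ) : 𝓞 ℚ) ∈ v.asIdeal.under (𝓞 ℚ) := by
    rw [Ideal.under_def, Ideal.mem_comap, map_natCast]; exact h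
  rw [hw, Rat.natCast_mem_asIdeal_iff] at hk'
  rwa [show natGenerator v₀ = ℓ from hv₀] at hk'

section Dictionary

variable {W : WeierstrassCurve ℚ} [W.IsGloballyMinimal]

/-! ## `hsplit` at Zhang–Kolyvagin levels -/

/-- **`hsplit` from class field theory, at Zhang–Kolyvagin levels** — x11b3's `hsplit_of_ringClassField` re-keyed:
for level data whose Kolyvagin point `P_m` is `e_m(K[m])`-rational (`hrat`, Gross (4.1)), at every square-free
`m` with Zhang–Kolyvagin prime factors, prime `ℓ ∣ m`, `λ ∋ ℓ`, `𝔓 ∣ λ` and arithmetic Frobenius `F` at `𝔓`: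
`F • P_{m/ℓ} = P_{m/ℓ}` (`λ = (ℓ)`, `ℓ ∤ m/ℓ`, splits completely in `K[m/ℓ]`:
`mem_splitPrimes_ringClassField_of_span_natCast`; `smul_algHom_eq_self_of_mem_splitPrimes`).
[cite: GrossLMS1991, §3 (p. 218 l. 1), §4 (4.1)] [cite: McCallumLMS1991, §4 (p. 301 l. 1)] [cite: WZhang2014, Notations (xii)] -/
theorem hsplit_of_ringClassField_zhang (hK : IsImaginaryQuadratic K)
    (ι : K →+* ℂ) {p M : ℕ}
    {𝒢 : ℕ → Type*} [∀ m, CommGroup (𝒢 m)] {A₀ : ℕ → Type*} [∀ m, AddCommGroup (A₀ m)]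
    [∀ m, DistribMulAction (𝒢 m) (A₀ m)]
    (σ : ∀ m, ℕ → 𝒢 m) (L : ℕ → Finset ℕ) (H : ∀ m, Subgroup (𝒢 m))
    [∀ m, Fintype (𝒢 m ⧸ H m)] (f : ∀ m, 𝒢 m ⧸ H m → 𝒢 m) (y : ∀ m, A₀ m)
    (j : ∀ m, A₀ m →+ geomPoints (W.baseChange K))
    (e : ∀ m, ringClassField K ι m →ₐ[K] AlgebraicClosure K)
    (hrat : ∀ m : ℕ, m ≠ 0 → ∀ Φ : absoluteGaloisGroup K,
      (∀ x : ringClassField K ι m, Φ • e m x = e m x) →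
      Φ • j m (kolyvaginPoint (σ m) (L m) (f m) (y m)) = j m (kolyvaginPoint (σ m) (L m) (f m) (y m)))
    (R : ℕ → ℕ → Prop) :
    ∀ m : ℕ, Squarefree m →
      (∀ q ∈ m.primeFactors, Zhang2014.IsKolyvaginPrime (W.conductorNorm ℤ) W K p q ∧
        M ≤ Zhang2014.kolyvaginIndex W p q) →
      ∀ ℓ : ℕ, ℓ.Prime → ℓ ∣ m → R m ℓ → ∀ v : HeightOneSpectrum (𝓞 K), (ℓ : 𝓞 K) ∈ v.asIdeal →
      ∀ 𝔓 ∈ v.primesAbove, ∀ F : absoluteGaloisGroup K, IsArithFrobAt (𝓞 K) F 𝔓 →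
        F • j (m / ℓ) (kolyvaginPoint (σ (m / ℓ)) (L (m / ℓ)) (f (m / ℓ)) (y (m / ℓ))) =
          j (m / ℓ) (kolyvaginPoint (σ (m / ℓ)) (L (m / ℓ)) (f (m / ℓ)) (y (m / ℓ))) := by
  intro m hm hkol ℓ hℓp hℓm _ v hv 𝔓 h𝔓 F hF
  have hm0 : m ≠ 0 := Squarefree.ne_zero hm
  obtain ⟨hℓ, -⟩ := hkol ℓ (Nat.mem_primeFactors.mpr ⟨hℓp, hℓm, hm0⟩)
  have hm' : m / ℓ ≠ 0 := (Nat.div_pos (Nat.le_of_dvd (Nat.pos_of_ne_zero hm0) hℓm) hℓp.pos).ne'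
  have hℓm' : ¬ ℓ ∣ m / ℓ := not_dvd_div_of_squarefree_of_prime hm hℓp hℓm
  haveI := (finiteDimensional_and_isGalois_ringClassField hK ι hm').1
  haveI := (finiteDimensional_and_isGalois_ringClassField hK ι hm').2
  haveI : NumberField (ringClassField K ι (m / ℓ)) := NumberField.of_module_finite K _
  have hvs : v ∈ splitPrimes K (ringClassField K ι (m / ℓ)) :=
    mem_splitPrimes_ringClassField_of_span_natCast hK ι hm'
      (asIdeal_eq_span_of_natCast_mem hℓp hℓ.2.2.2.2.1 hv)
      ((Nat.Prime.coprime_iff_not_dvd hℓp).mpr hℓm')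
  exact hrat (m / ℓ) hm' F fun x ↦ smul_algHom_eq_self_of_mem_splitPrimes (e (m / ℓ)) hvs h𝔓 hF x

/-! ## `htot` at Zhang–Kolyvagin levels -/

/-- **`htot` (total ramification of `λ_m` in `K_m/K_{m/ℓ}`) at Zhang–Kolyvagin levels** — x11b3's
`htot_of_classFieldTheory` re-keyed: for every square-free `m` with Zhang–Kolyvagin prime factors, prime `ℓ ∣ m`,
`λ ∋ ℓ`, `𝔓 ∣ λ` and `g ∈ G_ℓ = Gal(K[m]/K[m] ∩ K[m/ℓ])`, some `τ ∈ I_𝔓` induces `g` on `e_m(K[m])`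
(`RingClassTower.exists_mem_inertia_smul_eq_of_mem_ringClassGalOver`, the tree's class field theory).
[cite: GrossLMS1991, §3 (p. 218 l. 1)] [cite: McCallumLMS1991, §4 (p. 301 l. 1)] [cite: WZhang2014, Notations (xii)] -/
theorem htot_of_classFieldTheory_zhang (hK : IsImaginaryQuadratic K) (ι : K →+* ℂ) {p M : ℕ}
    (e : ∀ m, ringClassField K ι m →ₐ[K] AlgebraicClosure K) :
    ∀ m : ℕ, Squarefree m →
      (∀ q ∈ m.primeFactors, Zhang2014.IsKolyvaginPrime (W.conductorNorm ℤ) W K p q ∧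
        M ≤ Zhang2014.kolyvaginIndex W p q) →
      ∀ ℓ : ℕ, ℓ.Prime → ℓ ∣ m → ∀ v : HeightOneSpectrum (𝓞 K), (ℓ : 𝓞 K) ∈ v.asIdeal →
      ∀ 𝔓 ∈ v.primesAbove, ∀ g ∈ ringClassGalOver ι m (m / ℓ),
        ∃ τ ∈ 𝔓.inertia (absoluteGaloisGroup K),
          ∀ x : ringClassField K ι m, τ • e m x = e m (g x) := by
  intro m hm hkol ℓ hℓp hℓm v hv 𝔓 h𝔓 g hg
  have hm0 : m ≠ 0 := Squarefree.ne_zero hm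
  obtain ⟨hℓ, -⟩ := hkol ℓ (Nat.mem_primeFactors.mpr ⟨hℓp, hℓm, hm0⟩)
  have hℓm' : ¬ ℓ ∣ m / ℓ := not_dvd_div_of_squarefree_of_prime hm hℓp hℓm
  exact RingClassTower.exists_mem_inertia_smul_eq_of_mem_ringClassGalOver hK ι hm0 hℓp hℓm hℓm'
    (fun w ↦ ⟨fun hw ↦ Summit.BirchSwinnertonDyer.Rank1Residual.JET.RingClassTransverse.eq_of_natCast_mem_of_isPrime_span
      K hℓp hℓ.2.2.2.2.1 v w hv hw, fun h ↦ h ▸ hv⟩) h𝔓 (e m) hg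

/-! ## `hram` at the guarded Zhang–Kolyvagin pairs -/

/-- **`hram` from total ramification, at the Zhang–Kolyvagin pairs `(m, ℓ)` with `R m ℓ`** — x11b3's
`hram_of_totallyRamified_on` re-keyed and pair-guarded: from the dictionary conjunct `hσρ` (`ρ_m(⟨σ_m ℓ⟩) = G_ℓ`)
at the guarded pairs and `htot` (a theorem: `htot_of_classFieldTheory_zhang`), at every guarded pair with `λ ∋ ℓ`,
`𝔓 ∣ λ`: (i) some `τ₀ ∈ I_𝔓` has `π_m τ₀ = σ_m ℓ`; (ii) every `τ ∈ I_𝔓` acts on `j_m(A₀ m)` as a power of `τ₀`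
(`K[m/ℓ]` is unramified at `λ ∤ m/ℓ`, so `τ` fixes `K[m] ∩ K[m/ℓ]`, i.e. lies in `G_ℓ`). Proof verbatim.
[cite: GrossLMS1991, §3 (p. 217 l. 1–3, p. 218 l. 1)] [cite: McCallumLMS1991, §4 (p. 301 l. 1)] [cite: Cox2013, §9.A] -/
theorem hram_of_totallyRamified_at_zhang (hK : IsImaginaryQuadratic K) (ι : K →+* ℂ) {p M : ℕ}
    {𝒢 : ℕ → Type*} [∀ m, CommGroup (𝒢 m)] {A₀ : ℕ → Type*} [∀ m, AddCommGroup (A₀ m)]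
    [∀ m, DistribMulAction (𝒢 m) (A₀ m)]
    (σ : ∀ m, ℕ → 𝒢 m)
    (π : ∀ m, absoluteGaloisGroup K →* 𝒢 m) (j : ∀ m, A₀ m →+ geomPoints (W.baseChange K))
    (hj : ∀ m (g : absoluteGaloisGroup K) (a : A₀ m), j m (π m g • a) = g • j m a)
    (e : ∀ m, ringClassField K ι m →ₐ[K] AlgebraicClosure K)
    (ρ : ∀ m, 𝒢 m →* (ringClassField K ι m ≃ₐ[ℚ] ringClassField K ι m))
    (hρ : ∀ m, Function.Injective (ρ m))
    (hπρ : ∀ m (τ : absoluteGaloisGroup K) (x : ringClassField K ι m),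
      τ • e m x = e m (ρ m (π m τ) x))
    (R : ℕ → ℕ → Prop)
    (hσρ : ∀ m : ℕ, ∀ ℓ ∈ m.primeFactors, R m ℓ →
      (Subgroup.zpowers (σ m ℓ)).map (ρ m) = ringClassGalOver ι m (m / ℓ))
    (htot : ∀ m : ℕ, Squarefree m →
      (∀ q ∈ m.primeFactors, Zhang2014.IsKolyvaginPrime (W.conductorNorm ℤ) W K p q ∧
        M ≤ Zhang2014.kolyvaginIndex W p q) →
      ∀ ℓ : ℕ, ℓ.Prime → ℓ ∣ m → ∀ v : HeightOneSpectrum (𝓞 K), (ℓ : 𝓞 K) ∈ v.asIdeal →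
      ∀ 𝔓 ∈ v.primesAbove, ∀ g ∈ ringClassGalOver ι m (m / ℓ),
        ∃ τ ∈ 𝔓.inertia (absoluteGaloisGroup K),
          ∀ x : ringClassField K ι m, τ • e m x = e m (g x)) :
    ∀ m : ℕ, Squarefree m →
      (∀ q ∈ m.primeFactors, Zhang2014.IsKolyvaginPrime (W.conductorNorm ℤ) W K p q ∧
        M ≤ Zhang2014.kolyvaginIndex W p q) →
      ∀ ℓ : ℕ, ℓ.Prime → ℓ ∣ m → R m ℓ → ∀ v : HeightOneSpectrum (𝓞 K), (ℓ : 𝓞 K) ∈ v.asIdeal →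
      ∀ 𝔓 ∈ v.primesAbove, ∃ τ₀ ∈ 𝔓.inertia (absoluteGaloisGroup K), π m τ₀ = σ m ℓ ∧
        ∀ τ ∈ 𝔓.inertia (absoluteGaloisGroup K), ∃ i : ℕ, ∀ x ∈ (j m).range,
          τ • x = (τ₀ ^ i) • x := by
  intro m hm hkol ℓ hℓp hℓm hRm v hv 𝔓 h𝔓
  have hm0 : m ≠ 0 := Squarefree.ne_zero hm
  have hℓmem : ℓ ∈ m.primeFactors := Nat.mem_primeFactors.mpr ⟨hℓp, hℓm, hm0⟩
  haveI : Fact ℓ.Prime := ⟨hℓp⟩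
  have hm' : m / ℓ ≠ 0 := (Nat.div_pos (Nat.le_of_dvd (Nat.pos_of_ne_zero hm0) hℓm) hℓp.pos).ne'
  -- `λ ∤ m/ℓ` (`m` square-free)
  have hmv : ((m / ℓ : ℕ) : 𝓞 K) ∉ v.asIdeal := fun h ↦
    not_dvd_div_of_squarefree_of_prime hm hℓp hℓm (dvd_of_natCast_mem_of_isPrime_span hℓp hv h)
  -- (i) `σ_ℓ ∈ G_ℓ` is induced by an inertia element `τ₀`, and `π_m τ₀ = σ_ℓ`
  have hσmem : ρ m (σ m ℓ) ∈ ringClassGalOver ι m (m / ℓ) := by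
    rw [← hσρ m ℓ hℓmem hRm]
    exact Subgroup.mem_map_of_mem _ (Subgroup.mem_zpowers _)
  obtain ⟨τ₀, hτ₀I, hτ₀⟩ := htot m hm hkol ℓ hℓp hℓm v hv 𝔓 h𝔓 _ hσmem
  have hπτ₀ : π m τ₀ = σ m ℓ := by
    refine hρ m (AlgEquiv.ext fun x ↦ ?_)
    have h := hτ₀ x
    rw [hπρ] at h
    exact (e m).injective h
  refine ⟨τ₀, hτ₀I, hπτ₀, fun τ hτ ↦ ?_⟩
  -- (ii) `τ ∈ I_𝔓` fixes `K[m] ∩ K[m/ℓ]`, so `ρ_m (π_m τ) ∈ G_ℓ = ρ_m(⟨σ_ℓ⟩)`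
  have hmem : ρ m (π m τ) ∈ ringClassGalOver ι m (m / ℓ) := by
    rw [ringClassGalOver, mem_fixingSubgroup_iff]
    intro x hx
    rw [AlgEquiv.smul_def]
    have h := smul_algHom_ringClassField_eq_self_of_mem_inertia hK ι hm' (e m) hmv h𝔓 hτ hx
    rw [hπρ] at h
    exact (e m).injective h
  rw [← hσρ m ℓ hℓmem hRm, Subgroup.mem_map] at hmem
  obtain ⟨g, hg, hgeq⟩ := hmem
  have hπτ : π m τ ∈ Subgroup.zpowers (σ m ℓ) := by rwa [← hρ m hgeq]
  -- `σ_ℓ` has finite order (`ρ_m` is injective into the finite group `Aut(K[m])`)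
  haveI := (finiteDimensional_and_isGalois_ringClassField hK ι hm0).1
  haveI : FiniteDimensional ℚ (ringClassField K ι m) := Module.Finite.trans K (ringClassField K ι m)
  have hfin : IsOfFinOrder (σ m ℓ) := by
    obtain ⟨d, hd, hd1⟩ := (isOfFinOrder_of_finite (ρ m (σ m ℓ))).exists_pow_eq_one
    exact isOfFinOrder_iff_pow_eq_one.mpr ⟨d, hd, hρ m (by rw [map_pow, hd1, map_one])⟩
  obtain ⟨i, hi⟩ := (hfin.mem_powers_iff_mem_zpowers).mpr hπτ
  have hi' : σ m ℓ ^ i = π m τ := hi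
  refine ⟨i, ?_⟩
  rintro x ⟨a, rfl⟩
  rw [← hj, ← hj, map_pow, hπτ₀, hi']

/-! ## The END at the guarded Zhang–Kolyvagin pairs -/

/-- **`h44` (McCallum 1991, Prop. 4.4 at `λ ∣ m`, order form) at the Zhang–Kolyvagin PAIRS `(m, ℓ)` with `R m ℓ`,
from Gross's Prop. 3.7 and the Galois dictionary** — x11b3's `KolyvaginH44.h44_of_prop37_on` re-keyed to the
antecedent `Zhang2014.IsKolyvaginPrime (W.conductorNorm ℤ) W K p q ∧ M ≤ kolyvaginIndex W p q` and pair-guarded: the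
labelled input `h37` (Gross Prop. 3.7 (1) *"`Tr_ℓ y_n = a_ℓ · y_m`"* and (2) *"`y_n ≡ Frob(λ_m)(y_m) (mod λ_n)`"* with
the inter-level lift `y'`) and the dictionary conjunct `hσρ` (`ρ_m(⟨σ_m ℓ⟩) = Gal(K[m]/K[m] ∩ K[m/ℓ])`) are assumed
ONLY at the guarded pairs; `hsplit`, `hrat`, `htot`, `hram` are discharged by name
(`hsplit_of_ringClassField_zhang`, x11b3's `hrat_of_galoisDictionary`, `htot_of_classFieldTheory_zhang`,
`hram_of_totallyRamified_at_zhang`); the core is `h44_of_prop37_of_ringClassDecomposition_at_zhang`. For all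
guarded pairs, `λ ∋ ℓ` and `a`: `p^a c_M(m) ∈ Sel_λ ↔ p^a c_M(m/ℓ)_λ = 0`. HONEST: `h37` NOT discharged; `h44`
NOT discharged; image-free; nothing booked. [cite: GrossLMS1991, Prop. 3.7, §3 p. 217 l. 1–3, p. 218 l. 1, §4 (4.1),
Prop. 6.2 (2)] [cite: McCallumLMS1991, Prop. 4.4, Lemma 4.3, §4 (p. 301 l. 1)] [cite: WZhang2014, Notations (xii)] -/
theorem h44_of_prop37_at_zhang [W.IsElliptic]
    (hK : IsImaginaryQuadratic K) (ι : K →+* ℂ)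
    {p M : ℕ} (hp : p.Prime) (hp2 : p ≠ 2) (hM : 1 ≤ M)
    (hdiv : ∀ Q : geomPoints (W.baseChange K), ∃ R, ((p ^ M : ℕ) : ℤ) • R = Q)
    {𝒢 : ℕ → Type*} [∀ m, CommGroup (𝒢 m)] {A₀ : ℕ → Type*} [∀ m, AddCommGroup (A₀ m)]
    [∀ m, DistribMulAction (𝒢 m) (A₀ m)]
    (σ : ∀ m, ℕ → 𝒢 m) (L : ℕ → Finset ℕ) (H : ∀ m, Subgroup (𝒢 m))
    [∀ m, Fintype (𝒢 m ⧸ H m)] (f : ∀ m, 𝒢 m ⧸ H m → 𝒢 m)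
    (hord : ∀ m, ∀ ℓ ∈ L m, σ m ℓ ^ (ℓ + 1) = 1)
    (y : ∀ m, A₀ m)
    (π : ∀ m, absoluteGaloisGroup K →* 𝒢 m) (j : ∀ m, A₀ m →+ geomPoints (W.baseChange K))
    (hj : ∀ m (g : absoluteGaloisGroup K) (a : A₀ m), j m (π m g • a) = g • j m a)
    (hA : ∀ m, IsAdmissible (absoluteGaloisGroup K) (j m).range ((p ^ M : ℕ) : ℤ))
    (hPt : ∀ m, j m (kolyvaginPoint (σ m) (L m) (f m) (y m)) ∈
      invPoints (absoluteGaloisGroup K) (j m).range ((p ^ M : ℕ) : ℤ))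
    (hI : ∀ m : ℕ, ∀ v : HeightOneSpectrum (𝓞 K), (m : 𝓞 K) ∉ v.asIdeal →
      ∀ 𝔐 ∈ v.localPrimesAbove, ∀ t ∈ 𝔐.inertia (absoluteGaloisGroup (v.adicCompletion K)),
        resGal (K := K) (v.adicCompletion K) t • j m (kolyvaginPoint (σ m) (L m) (f m) (y m)) =
          j m (kolyvaginPoint (σ m) (L m) (f m) (y m)))
    (R : ℕ → ℕ → Prop)
    (h37 : ∀ m : ℕ, Squarefree m →
      (∀ q ∈ m.primeFactors, Zhang2014.IsKolyvaginPrime (W.conductorNorm ℤ) W K p q ∧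
        M ≤ Zhang2014.kolyvaginIndex W p q) →
      ∀ ℓ : ℕ, ℓ.Prime → ℓ ∣ m → R m ℓ →
      ℓ ∈ L m ∧ ∃ y' : A₀ m,
        j m (kolyvaginPoint (σ m) ((L m).erase ℓ) (f m) y') =
          j (m / ℓ) (kolyvaginPoint (σ (m / ℓ)) (L (m / ℓ)) (f (m / ℓ)) (y (m / ℓ))) ∧
        grAct (A₀ m) (traceElt (σ m ℓ) ℓ) (y m) = W.frobeniusTrace ℓ • y' ∧
        ∀ [Fact ℓ.Prime] (hΔ : ¬ (ℓ : ℤ) ∣ minimalDiscriminantInt W)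
          (φ₀ : absoluteGaloisGroup (ZMod ℓ)), (∀ x : AlgebraicClosure (ZMod ℓ), φ₀ • x = x ^ ℓ) →
          ∀ γ : 𝒢 m, geomReduction hΔ ((RatClosure.pointsEquiv (K := K) W).symm (j m (γ • y m))) =
            φ₀ • geomReduction hΔ ((RatClosure.pointsEquiv (K := K) W).symm (j m (γ • y'))))
    (e : ∀ m, ringClassField K ι m →ₐ[K] AlgebraicClosure K)
    (ρ : ∀ m, 𝒢 m →* (ringClassField K ι m ≃ₐ[ℚ] ringClassField K ι m))
    (hρ : ∀ m, Function.Injective (ρ m))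
    (hπρ : ∀ m (τ : absoluteGaloisGroup K) (x : ringClassField K ι m),
      τ • e m x = e m (ρ m (π m τ) x))
    (hσρ : ∀ m : ℕ, ∀ ℓ ∈ m.primeFactors, R m ℓ →
      (Subgroup.zpowers (σ m ℓ)).map (ρ m) = ringClassGalOver ι m (m / ℓ)) :
    ∀ m : ℕ, Squarefree m →
      (∀ q ∈ m.primeFactors, Zhang2014.IsKolyvaginPrime (W.conductorNorm ℤ) W K p q ∧
        M ≤ Zhang2014.kolyvaginIndex W p q) →
      ∀ ℓ : ℕ, ℓ.Prime → ℓ ∣ m → R m ℓ → ∀ v : HeightOneSpectrum (𝓞 K), (ℓ : 𝓞 K) ∈ v.asIdeal →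
        ∀ a : ℕ, (((p : ℤ) ^ a) • kolyvaginClass (W.baseChange K) _ hdiv (hA m)
              (j m (kolyvaginPoint (σ m) (L m) (f m) (y m))) (hPt m) ∈
            selmerLocalKer (W.baseChange K) (v.adicCompletion K) ((p ^ M : ℕ) : ℤ) ↔
          ((p : ℤ) ^ a) • kolyvaginClass (W.baseChange K) _ hdiv (hA (m / ℓ))
              (j (m / ℓ) (kolyvaginPoint (σ (m / ℓ)) (L (m / ℓ)) (f (m / ℓ)) (y (m / ℓ))))
              (hPt (m / ℓ)) ∈
            (W.baseChange K).torsionLocalKer (v.adicCompletion K) ((p ^ M : ℕ) : ℤ)) :=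
  h44_of_prop37_of_ringClassDecomposition_at_zhang hK hp hp2 hM hdiv σ L H f hord y π j hj hA hPt hI R h37
    (hsplit_of_ringClassField_zhang (p := p) (M := M) hK ι σ L H f y j e
      (hrat_of_galoisDictionary ι σ L H f y π j hj e ρ hρ hπρ) R)
    (hram_of_totallyRamified_at_zhang (W := W) (p := p) (M := M) hK ι σ π j hj e ρ hρ hπρ R hσρ
      (htot_of_classFieldTheory_zhang (W := W) (p := p) (M := M) hK ι e))

end Dictionary

end Summit.BirchSwinnertonDyer.BirchSwinnertonDyer.Theorems.Prop44

end
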